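import Literature.AlgebraicGeometry.Motives.HodgeThetaSubalgebraUnitaryOrthogonalChain
import Literature.AlgebraicGeometry.Motives.HodgeThetaSubalgebraUnitaryFortyOneFortyThreeGoodRankCores
import Literature.AlgebraicGeometry.Motives.HodgeThetaSubalgebraUnitaryThirtyOneSixtySixCorePart2
import HarnessLib
import Literature.AlgebraicGeometry.Motives.HodgeThetaSubalgebraUnitaryEightNineCore
import Literature.AlgebraicGeometry.Motives.HodgeThetaSubalgebraUnitaryFiveCoreAll
import Literature.AlgebraicGeometry.Motives.HodgeThetaSubalgebraUnitarySixSevenCoreAll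
import Literature.AlgebraicGeometry.Motives.HodgeThetaSubalgebraUnitaryThreeCoprimeCore
import Literature.AlgebraicGeometry.Motives.HodgeThetaSubalgebraUnitaryTwelveThirteenCore

/-!
# The `Θ`-subalgebra theorem for unitary multiplicities `(31, 66)` — a `p = 97` cell by minimal-rank base points
# and sub-Levi recursion (Ribet 1983 Thm. 3, Lie step; abelian 97-folds of type `(31, 66)`)

Family `hodge`, layer `Literature/AlgebraicGeometry/Motives` (pure linear algebra over `ℂ`; no geometry). Research
context: cell `pub-hodge-ring2` (HONEST FRAMING: research route conditional on HC_CM; not a corollary; Q11.4-sentence-2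
already refuted in dim ≥ 3), Literature lane gen 90. UNCONDITIONAL; theorems only, no definition, no named fact
(D-0026), no `sorry`.

THE PRINT. K. A. Ribet, Amer. J. Math. 105 (1983), Thm. 3 = Gordon's survey Thm. 6.3 (3) [held
`paper:arxiv-alg-geom_9709030` p. 18]. THE METHOD: `HodgeThetaSubalgebraUnitarySixteenTwentyOneCore` (a raising operator
`B` of MINIMAL non-zero rank `m`, the profile dichotomy `i + j ≤ m` or `i, j ≥ m`, tree cores making a Levi algebra full
or killing a Levi rank, lifts `UnitaryRaisingSpace.exists_raise_finrank_range_eq` + `UnitaryLeviSetup.exists_lift`, two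
pencils `UnitaryGenericRank.exists_finrank_le_and_finrank_le`, the non-vanishing lemma
`UnitaryLeviFull.exists_raise_commute_apply_ne_zero`, TOOL C `UnitaryConstantRank.exists_raise_rank_ne_two`, TOOL F
`UnitaryConstantRank.false_of_le_rank`), the full-rank chain `UnitaryConstantRank.dvd_of_rank_eq_finrank`
(`HodgeThetaSubalgebraUnitaryNineTwentyEightCore`) and TOOL G `UnitaryOrthogonalChain.false_of_constProfile`.

THIS FILE assembles the core from the lemma files `HodgeThetaSubalgebraUnitaryThirtyOneSixtySixCorePart1` … `HodgeThetaSubalgebraUnitaryThirtyOneSixtySixCorePart2` (split for the gate's 200 kB cap).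

THE CELL `(31 | 66)`. Good ranks 1, 5, 7, 13 (Levi types `(1|65)`, `(5|61)`, `(7|59)`, `(13|53)` are tree cores); a proper `𝔊` has
raising ranks in `{0, 2, 3, 4, 6, 8, 9, 10, 11, 12, 14, 15, 16, 17, 18, 19, 20, 21, 22, 23, 24, 25, 26, 27, 28, 29, 30, 31}`; `m` minimal non-zero, `B` of rank `m`; a commuting raising `X` has profile
`(i, j)` (`i + j` a raising rank, `i + j ≤ m` or `i, j ≥ m`). SUB-LEVI RECURSION: when the non-zero profiles are constantly
`(i, j)`, the Levi algebra `L⁺` (resp. `L⁻`) is a `Θ`-algebra whose non-zero raising ranks are all `i` (resp. `j`), and the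
same minimal-rank analysis applies to it (the `sub…` lemmas of §1).
* `m = 2` (`U⁺` of type `(29 | 2)`, `U⁻` of type `(2 | 64)`): `L⁺` of type `(29 | 2)` is full and a lift with `i = 1` has `j ∈ {1}`, killed in `L⁻` (type `(2 | 64)`).
* `m = 3` (`U⁺` of type `(28 | 3)`, `U⁻` of type `(3 | 63)`): `L⁺` of type `(28 | 3)` is full and a lift with `i = 1` has `j ∈ {2}`, killed in `L⁻` (type `(3 | 63)`).
* `m = 4` (`U⁺` of type `(27 | 4)`, `U⁻` of type `(4 | 62)`): `L⁺` of type `(27 | 4)` is full and a lift with `i = 1` has `j ∈ {3}`, killed in `L⁻` (type `(4 | 62)`).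
* `m = 6` (`U⁺` of type `(25 | 6)`, `U⁻` of type `(6 | 60)`): `L⁺` of type `(25 | 6)` is full and a lift with `i = 5` has `j ∈ {1}`, killed in `L⁻` (type `(6 | 60)`).
* `m = 8` (`U⁺` of type `(23 | 8)`, `U⁻` of type `(8 | 58)`): `L⁺` of type `(23 | 8)` is full and a lift with `i = 1` has `j ∈ {7}`, killed in `L⁻` (type `(8 | 58)`).
* `m = 9` (`U⁺` of type `(22 | 9)`, `U⁻` of type `(9 | 57)`): `L⁺` of type `(22 | 9)` is full and a lift with `i = 2` has `j ∈ {7}`, killed in `L⁻` (type `(9 | 57)`).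
* `m = 10` (`U⁺` of type `(21 | 10)`, `U⁻` of type `(10 | 56)`): `L⁺` of type `(21 | 10)` is full and a lift with `i = 5` has `j ∈ {5}`, killed in `L⁻` (type `(10 | 56)`).
* `m = 11` (`U⁺` of type `(20 | 11)`, `U⁻` of type `(11 | 55)`): `L⁺` of type `(20 | 11)` is full and a lift with `i = 4` has `j ∈ {7}`, killed in `L⁻` (type `(11 | 55)`).
* `m = 12` (`U⁺` of type `(19 | 12)`, `U⁻` of type `(12 | 54)`): `L⁺` of type `(19 | 12)` is full and a lift with `i = 1` has `j ∈ {11}`, killed in `L⁻` (type `(12 | 54)`).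
* `m = 14` (`U⁺` of type `(17 | 14)`, `U⁻` of type `(14 | 52)`): `L⁺` of type `(17 | 14)` is full and a lift with `i = 3` has `j ∈ {11}`, killed in `L⁻` (type `(14 | 52)`).
* `m = 15` (`U⁺` of type `(16 | 15)`, `U⁻` of type `(15 | 51)`): `L⁺` of type `(16 | 15)` is full and a lift with `i = 2` has `j ∈ {13}`, killed in `L⁻` (type `(15 | 51)`).
* `m = 16` (`U⁺` of type `(15 | 16)`, `U⁻` of type `(16 | 50)`): `L⁺` of type `(15 | 16)` is full and a lift with `i = 3` has `j ∈ {13}`, killed in `L⁻` (type `(16 | 50)`).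
* `m = 17` (`U⁺` of type `(14 | 17)`, `U⁻` of type `(17 | 49)`): `L⁺` of type `(14 | 17)` is full and a lift with `i = 4` has `j ∈ {13}`, killed in `L⁻` (type `(17 | 49)`).
* `m = 18` (`U⁺` of type `(13 | 18)`, `U⁻` of type `(18 | 48)`): `L⁺` of type `(13 | 18)` is full and a lift with `i = 5` has `j ∈ {13}`, killed in `L⁻` (type `(18 | 48)`).
* `m = 19` (`U⁺` of type `(12 | 19)`, `U⁻` of type `(19 | 47)`): `L⁺` of type `(12 | 19)` is full and a lift with `i = 1` has `j ∈ {18}`, killed in `L⁻` (type `(19 | 47)`).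
* `m = 20` (`U⁺` of type `(11 | 20)`, `U⁻` of type `(20 | 46)`): `L⁺` of type `(11 | 20)` is full and a lift with `i = 7` has `j ∈ {13}`, killed in `L⁻` (type `(20 | 46)`).
* `m = 21` (`U⁺` of type `(10 | 21)`, `U⁻` of type `(21 | 45)`): `L⁺` of type `(10 | 21)` is full and a lift with `i = 8` has `j ∈ {13}`, killed in `L⁻` (type `(21 | 45)`).
* `m = 22` (`U⁺` of type `(9 | 22)`, `U⁻` of type `(22 | 44)`): `L⁺` of type `(9 | 22)` is full and a lift with `i = 9` has `j ∈ {13}`, killed in `L⁻` (type `(22 | 44)`).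
* `m = 23` (`U⁺` of type `(8 | 23)`, `U⁻` of type `(23 | 43)`): `L⁺` of type `(8 | 23)` is full and a lift with `i = 1` has `j ∈ {22}`, killed in `L⁻` (type `(23 | 43)`).
* `m = 24` (`U⁺` of type `(7 | 24)`, `U⁻` of type `(24 | 42)`): `L⁺` of type `(7 | 24)` is full; two pencils (lifts with `i = 1`, `i = 2`).
* `m = 25` (`U⁺` of type `(6 | 25)`, `U⁻` of type `(25 | 41)`): `L⁺` of type `(6 | 25)` is full and a lift with `i = 1` has `j ∈ {24}`, killed in `L⁻` (type `(25 | 41)`).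
* `m = 26` (`U⁺` of type `(5 | 26)`, `U⁻` of type `(26 | 40)`): `L⁺` of type `(5 | 26)` is full; two pencils (lifts with `i = 1`, `i = 2`).
* `m = 27` (`U⁺` of type `(4 | 27)`, `U⁻` of type `(27 | 39)`): `L⁺` of type `(4 | 27)` is full; two pencils (lifts with `i = 1`, `i = 2`).
* `m = 28` (`U⁺` of type `(3 | 28)`, `U⁻` of type `(28 | 38)`): `L⁺` of type `(3 | 28)` is full and a lift with `i = 1` has `j ∈ {27}`, killed in `L⁻` (type `(28 | 38)`).
* `m = 29` (`U⁺` of type `(2 | 29)`, `U⁻` of type `(29 | 37)`): `L⁺` of type `(2 | 29)` is full and a lift with `i = 1` has `j ∈ {28}`, killed in `L⁻` (type `(29 | 37)`).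
* `m = 30` (`U⁺` of type `(1 | 30)`, `U⁻` of type `(30 | 36)`): `L⁺` of type `(1 | 30)` is full and a lift with `i = 1` has `j ∈ {29}`, killed in `L⁻` (type `(30 | 36)`).
* `m = 31 = dim P`: the full-rank chain would give `31 ∣ 66`.

## References
* [Ribet1983] K. A. Ribet, *Hodge classes on certain types of abelian varieties*, Amer. J. Math. 105 (1983), Thm. 3.
* [Gordon1997] B. B. Gordon, *A survey of the Hodge conjecture for abelian varieties*, Thm. 6.3 (3), pp. 18–19.
* [Deligne1982HodgeCycles] P. Deligne, *Hodge cycles on abelian varieties*, LNM 900 (1982), I §3 Prop. 3.4, 3.6.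
* [GoodmanWallachGTM255] R. Goodman, N. R. Wallach, GTM 255 (2009), §2.3.1, §4.1.1.
* [HoffmanKunze1971LinearAlgebra] K. Hoffman, R. Kunze, *Linear Algebra* (1971), §3.1 Thm. 2, §6.7, §8.5.
-/

noncomputable section

open Module

namespace Literature.AlgebraicGeometry.Motives

namespace HodgeStructure

universe u

variable {W : Type u} [AddCommGroup W] [Module ℂ W]

/-! ### §3 The `(31 | 66)` core -/

set_option maxHeartbeats 1600000 in
/-- **THE `Θ`-SUBALGEBRA THEOREM FOR UNITARY MULTIPLICITIES `(31, 66)` — complex Hermitian core, classification-free.**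
`𝔊 ⊆ End(W)` bracket-closed and irreducible, `Θ ∈ 𝔊` an involution with `dim P = 31`, `dim Q = 66`, Hermitian data,
`𝔊` adjoint-closed ⟹ `𝔊 = End(W)`. See the module docstring. [cite: Ribet1983, Thm. 3] [cite: Gordon1997, Thm. 6.3 (3)]
[cite: Deligne1982HodgeCycles, I §3 Prop. 3.4, 3.6] [cite: GoodmanWallachGTM255, §4.1.1] -/
theorem UnitaryThirtyOneSixtySix.eq_top_of_smul [FiniteDimensional ℂ W] {𝔊 : Submodule ℂ (Module.End ℂ W)}
    (hbr : ∀ Y ∈ 𝔊, ∀ Z ∈ 𝔊, Y * Z - Z * Y ∈ 𝔊)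
    (hirr : ∀ U : Submodule ℂ W, (∀ A ∈ 𝔊, ∀ u ∈ U, A u ∈ U) → U = ⊥ ∨ U = ⊤)
    {Θ : Module.End ℂ W} (hΘ : Θ ∈ 𝔊) (hΘΘ : Θ * Θ = 1)
    {P Q : Submodule ℂ W} (hP : ∀ x, x ∈ P ↔ Θ x = x) (hQ : ∀ x, x ∈ Q ↔ Θ x = -x)
    (hP31 : Module.finrank ℂ P = 31) (hQ66 : Module.finrank ℂ Q = 66)
    {s : W → W → ℂ} (hadd : ∀ x y z, s (x + y) z = s x z + s y z)
    (hsmul : ∀ (c : ℂ) (x y : W), s (c • x) y = c * s x y) (hsymm : ∀ x y, s y x = starRingEnd ℂ (s x y))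
    (hPQ : ∀ p ∈ P, ∀ q ∈ Q, s p q = 0) (hdefP : ∀ p ∈ P, s p p = 0 → p = 0) (hdefQ : ∀ q ∈ Q, s q q = 0 → q = 0)
    (hadj : ∀ X ∈ 𝔊, ∃ Y ∈ 𝔊, ∀ x y, s (X x) y = s x (Y y)) : 𝔊 = ⊤ := by
  classical
  have hraiseval : ∀ Z : Module.End ℂ W, Θ * Z = Z → ∀ w, Z w ∈ P := fun Z hΘZ w =>
    (hP _).2 (by rw [← Module.End.mul_apply, hΘZ])
  have hle : ∀ B' : Module.End ℂ W, Θ * B' = B' → Module.finrank ℂ (LinearMap.range B') ≤ 31 := fun B' h => by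
    rw [← hP31]
    exact Submodule.finrank_mono (by rintro _ ⟨w, rfl⟩; exact hraiseval B' h w)
  have hsU : ∀ U : Submodule ℂ W, ∀ x y z : U, s ((x + y : U) : W) z = s (x : W) z + s (y : W) z :=
    fun U x y z => by simp only [Submodule.coe_add, hadd]
  have hsmU : ∀ U : Submodule ℂ W, ∀ (c : ℂ) (x y : U), s ((c • x : U) : W) y = c * s (x : W) y :=
    fun U c x y => by simp only [Submodule.coe_smul, hsmul]
  have key : ∀ r, (r = 1 ∨ r = 5 ∨ r = 7 ∨ r = 13) →
      ∀ B' ∈ 𝔊, Θ * B' = B' → B' * Θ = -B' → Module.finrank ℂ (LinearMap.range B') = r → 𝔊 = ⊤ := by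
    intro r hr B' hB' hΘB' hB'Θ hrk
    refine UnitaryDoubleLevi.eq_top_of_raise_of_core hbr hirr hΘ hΘΘ hP hQ hadd hsymm hPQ hdefP hdefQ hadj hB' hΘB' hB'Θ
      (by omega) (by omega) (by omega)
      fun U 𝔩 ι P' Q' hbr𝔩 hirr𝔩 hι hιι hP' hQ' hfinP' hfinQ' hP'Q' hdefP' hdefQ' hadj𝔩 => ?_
    rw [hQ66, hrk] at hfinQ'
    rw [hrk] at hfinP'
    rcases hr with rfl | rfl | rfl | rfl
    · -- `(1 | 65)`
      exact UnitaryThreeCoprime.eq_top_of_finrank_eq_one hbr𝔩 hirr𝔩 (Submodule.neg_mem _ hι) ((neg_mul_neg ι ι).trans hιι) (P := Q') (Q := P') (fun x => by rw [hQ', LinearMap.neg_apply, neg_eq_iff_eq_neg]) (fun x => by rw [hP', LinearMap.neg_apply, neg_inj]) (by omega) hfinP'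
    · -- `(5 | 61)`
      exact UnitaryFive.eq_top_of_smul hbr𝔩 hirr𝔩 hι hιι hP' hQ' hfinP' (by omega) (s := fun x y : U => s (x : W) y) (fun x y z => by simp only [Submodule.coe_add, hadd]) (fun c x y => by simp only [Submodule.coe_smul, hsmul]) (fun x y => hsymm _ _) hP'Q' hdefP' hdefQ' hadj𝔩
    · -- `(7 | 59)`
      exact UnitarySeven.eq_top_of_smul hbr𝔩 hirr𝔩 hι hιι hP' hQ' hfinP' (by omega) (s := fun x y : U => s (x : W) y) (fun x y z => by simp only [Submodule.coe_add, hadd]) (fun c x y => by simp only [Submodule.coe_smul, hsmul]) (fun x y => hsymm _ _) hP'Q' hdefP' hdefQ' hadj𝔩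
    · -- `(13 | 53)`
      exact UnitaryThirteen.eq_top_of_smul hbr𝔩 hirr𝔩 hι hιι hP' hQ' hfinP' (by omega) (s := fun x y : U => s (x : W) y) (fun x y z => by simp only [Submodule.coe_add, hadd]) (fun c x y => by simp only [Submodule.coe_smul, hsmul]) (fun x y => hsymm _ _) hP'Q' hdefP' hdefQ' hadj𝔩
  by_contra hne
  have hbad : ∀ B' ∈ 𝔊, Θ * B' = B' → B' * Θ = -B' → Module.finrank ℂ (LinearMap.range B') = 0 ∨ Module.finrank ℂ (LinearMap.range B') = 2 ∨ Module.finrank ℂ (LinearMap.range B') = 3 ∨ Module.finrank ℂ (LinearMap.range B') = 4 ∨ Module.finrank ℂ (LinearMap.range B') = 6 ∨ Module.finrank ℂ (LinearMap.range B') = 8 ∨ Module.finrank ℂ (LinearMap.range B') = 9 ∨ Module.finrank ℂ (LinearMap.range B') = 10 ∨ Module.finrank ℂ (LinearMap.range B') = 11 ∨ Module.finrank ℂ (LinearMap.range B') = 12 ∨ Module.finrank ℂ (LinearMap.range B') = 14 ∨ Module.finrank ℂ (LinearMap.range B') = 15 ∨ Module.finrank ℂ (LinearMap.range B') = 16 ∨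 Module.finrank ℂ (LinearMap.range B') = 17 ∨ Module.finrank ℂ (LinearMap.range B') = 18 ∨ Module.finrank ℂ (LinearMap.range B') = 19 ∨ Module.finrank ℂ (LinearMap.range B') = 20 ∨ Module.finrank ℂ (LinearMap.range B') = 21 ∨ Module.finrank ℂ (LinearMap.range B') = 22 ∨ Module.finrank ℂ (LinearMap.range B') = 23 ∨ Module.finrank ℂ (LinearMap.range B') = 24 ∨ Module.finrank ℂ (LinearMap.range B') = 25 ∨ Module.finrank ℂ (LinearMap.range B') = 26 ∨ Module.finrank ℂ (LinearMap.range B') = 27 ∨ Module.finrank ℂ (LinearMap.range B') = 28 ∨ Module.finrank ℂ (LinearMap.range B') = 29 ∨ Module.finrank ℂ (LinearMap.range B') = 30 ∨ Module.finrank ℂ (LinearMap.range B') = 31 := by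
    intro B' hB' hΘB' hB'Θ
    have hle' := hle B' hΘB'
    have hk : ¬ (Module.finrank ℂ (LinearMap.range B') = 1 ∨ Module.finrank ℂ (LinearMap.range B') = 5 ∨ Module.finrank ℂ (LinearMap.range B') = 7 ∨ Module.finrank ℂ (LinearMap.range B') = 13) :=
      fun h => hne (key _ h B' hB' hΘB' hB'Θ rfl)
    generalize Module.finrank ℂ (LinearMap.range B') = R at hle' hk ⊢
    interval_cases R <;> omega
  obtain ⟨B₂, hB₂, hΘB₂, hB₂Θ, hr2⟩ :=
    UnitaryThreeCoprime.exists_raise_rank_ge_two hbr hirr hΘ hΘΘ hP hQ (by omega) (by omega)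
  obtain ⟨B, hB, hΘB, hBΘ, hB0, hBmin⟩ := UnitaryRaisingSpace.exists_minRank_raise 𝔊 Θ
    ⟨B₂, hB₂, hΘB₂, hB₂Θ, fun h => by rw [h, LinearMap.range_zero, finrank_bot] at hr2; omega⟩
  have hrB0 : Module.finrank ℂ (LinearMap.range B) ≠ 0 := fun h =>
    hB0 (LinearMap.range_eq_bot.1 (Submodule.finrank_eq_zero.1 h))
  have hSm : ∀ B' ∈ 𝔊, Θ * B' = B' → B' * Θ = -B' →
      Module.finrank ℂ (LinearMap.range B') = 0 ∨ Module.finrank ℂ (LinearMap.range B) ≤ Module.finrank ℂ (LinearMap.range B') := by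
    intro B' hB' hΘB' hB'Θ
    by_cases h0 : B' = 0
    · left; rw [h0, LinearMap.range_zero, finrank_bot]
    · exact Or.inr (hBmin B' hB' hΘB' hB'Θ h0)
  rcases hbad B hB hΘB hBΘ with h | h | h | h | h | h | h | h | h | h | h | h | h | h | h | h | h | h | h | h | h | h | h | h | h | h | h | h
  · exact hrB0 h
  · refine UnitaryThirtyOneSixtySix.no_minRank_2 hbr hirr hΘ hΘΘ hP hQ hP31 hQ66 hadd hsmul hsymm hPQ hdefP hdefQ
      hadj (fun B' hB' hΘB' hB'Θ => ?_) hB hΘB hBΘ h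
    have h2 := hSm B' hB' hΘB' hB'Θ
    rcases hbad B' hB' hΘB' hB'Θ with h1 | h1 | h1 | h1 | h1 | h1 | h1 | h1 | h1 | h1 | h1 | h1 | h1 | h1 | h1 | h1 | h1 | h1 | h1 | h1 | h1 | h1 | h1 | h1 | h1 | h1 | h1 | h1 <;> omega
  · refine UnitaryThirtyOneSixtySix.no_minRank_3 hbr hirr hΘ hΘΘ hP hQ hP31 hQ66 hadd hsmul hsymm hPQ hdefP hdefQ
      hadj (fun B' hB' hΘB' hB'Θ => ?_) hB hΘB hBΘ h
    have h2 := hSm B' hB' hΘB' hB'Θ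
    rcases hbad B' hB' hΘB' hB'Θ with h1 | h1 | h1 | h1 | h1 | h1 | h1 | h1 | h1 | h1 | h1 | h1 | h1 | h1 | h1 | h1 | h1 | h1 | h1 | h1 | h1 | h1 | h1 | h1 | h1 | h1 | h1 | h1 <;> omega
  · refine UnitaryThirtyOneSixtySix.no_minRank_4 hbr hirr hΘ hΘΘ hP hQ hP31 hQ66 hadd hsmul hsymm hPQ hdefP hdefQ
      hadj (fun B' hB' hΘB' hB'Θ => ?_) hB hΘB hBΘ h
    have h2 := hSm B' hB' hΘB' hB'Θ
    rcases hbad B' hB' hΘB' hB'Θ with h1 | h1 | h1 | h1 | h1 | h1 | h1 | h1 | h1 | h1 | h1 | h1 | h1 | h1 | h1 | h1 | h1 | h1 | h1 | h1 | h1 | h1 | h1 | h1 | h1 | h1 | h1 | h1 <;> omega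
  · refine UnitaryThirtyOneSixtySix.no_minRank_6 hbr hirr hΘ hΘΘ hP hQ hP31 hQ66 hadd hsmul hsymm hPQ hdefP hdefQ
      hadj (fun B' hB' hΘB' hB'Θ => ?_) hB hΘB hBΘ h
    have h2 := hSm B' hB' hΘB' hB'Θ
    rcases hbad B' hB' hΘB' hB'Θ with h1 | h1 | h1 | h1 | h1 | h1 | h1 | h1 | h1 | h1 | h1 | h1 | h1 | h1 | h1 | h1 | h1 | h1 | h1 | h1 | h1 | h1 | h1 | h1 | h1 | h1 | h1 | h1 <;> omega
  · refine UnitaryThirtyOneSixtySix.no_minRank_8 hbr hirr hΘ hΘΘ hP hQ hP31 hQ66 hadd hsmul hsymm hPQ hdefP hdefQ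
      hadj (fun B' hB' hΘB' hB'Θ => ?_) hB hΘB hBΘ h
    have h2 := hSm B' hB' hΘB' hB'Θ
    rcases hbad B' hB' hΘB' hB'Θ with h1 | h1 | h1 | h1 | h1 | h1 | h1 | h1 | h1 | h1 | h1 | h1 | h1 | h1 | h1 | h1 | h1 | h1 | h1 | h1 | h1 | h1 | h1 | h1 | h1 | h1 | h1 | h1 <;> omega
  · refine UnitaryThirtyOneSixtySix.no_minRank_9 hbr hirr hΘ hΘΘ hP hQ hP31 hQ66 hadd hsmul hsymm hPQ hdefP hdefQ
      hadj (fun B' hB' hΘB' hB'Θ => ?_) hB hΘB hBΘ h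
    have h2 := hSm B' hB' hΘB' hB'Θ
    rcases hbad B' hB' hΘB' hB'Θ with h1 | h1 | h1 | h1 | h1 | h1 | h1 | h1 | h1 | h1 | h1 | h1 | h1 | h1 | h1 | h1 | h1 | h1 | h1 | h1 | h1 | h1 | h1 | h1 | h1 | h1 | h1 | h1 <;> omega
  · refine UnitaryThirtyOneSixtySix.no_minRank_10 hbr hirr hΘ hΘΘ hP hQ hP31 hQ66 hadd hsmul hsymm hPQ hdefP hdefQ
      hadj (fun B' hB' hΘB' hB'Θ => ?_) hB hΘB hBΘ h
    have h2 := hSm B' hB' hΘB' hB'Θ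
    rcases hbad B' hB' hΘB' hB'Θ with h1 | h1 | h1 | h1 | h1 | h1 | h1 | h1 | h1 | h1 | h1 | h1 | h1 | h1 | h1 | h1 | h1 | h1 | h1 | h1 | h1 | h1 | h1 | h1 | h1 | h1 | h1 | h1 <;> omega
  · refine UnitaryThirtyOneSixtySix.no_minRank_11 hbr hirr hΘ hΘΘ hP hQ hP31 hQ66 hadd hsmul hsymm hPQ hdefP hdefQ
      hadj (fun B' hB' hΘB' hB'Θ => ?_) hB hΘB hBΘ h
    have h2 := hSm B' hB' hΘB' hB'Θ
    rcases hbad B' hB' hΘB' hB'Θ with h1 | h1 | h1 | h1 | h1 | h1 | h1 | h1 | h1 | h1 | h1 | h1 | h1 | h1 | h1 | h1 | h1 | h1 | h1 | h1 | h1 | h1 | h1 | h1 | h1 | h1 | h1 | h1 <;> omega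
  · refine UnitaryThirtyOneSixtySix.no_minRank_12 hbr hirr hΘ hΘΘ hP hQ hP31 hQ66 hadd hsmul hsymm hPQ hdefP hdefQ
      hadj (fun B' hB' hΘB' hB'Θ => ?_) hB hΘB hBΘ h
    have h2 := hSm B' hB' hΘB' hB'Θ
    rcases hbad B' hB' hΘB' hB'Θ with h1 | h1 | h1 | h1 | h1 | h1 | h1 | h1 | h1 | h1 | h1 | h1 | h1 | h1 | h1 | h1 | h1 | h1 | h1 | h1 | h1 | h1 | h1 | h1 | h1 | h1 | h1 | h1 <;> omega
  · refine UnitaryThirtyOneSixtySix.no_minRank_14 hbr hirr hΘ hΘΘ hP hQ hP31 hQ66 hadd hsmul hsymm hPQ hdefP hdefQ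
      hadj (fun B' hB' hΘB' hB'Θ => ?_) hB hΘB hBΘ h
    have h2 := hSm B' hB' hΘB' hB'Θ
    rcases hbad B' hB' hΘB' hB'Θ with h1 | h1 | h1 | h1 | h1 | h1 | h1 | h1 | h1 | h1 | h1 | h1 | h1 | h1 | h1 | h1 | h1 | h1 | h1 | h1 | h1 | h1 | h1 | h1 | h1 | h1 | h1 | h1 <;> omega
  · refine UnitaryThirtyOneSixtySix.no_minRank_15 hbr hirr hΘ hΘΘ hP hQ hP31 hQ66 hadd hsmul hsymm hPQ hdefP hdefQ
      hadj (fun B' hB' hΘB' hB'Θ => ?_) hB hΘB hBΘ h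
    have h2 := hSm B' hB' hΘB' hB'Θ
    rcases hbad B' hB' hΘB' hB'Θ with h1 | h1 | h1 | h1 | h1 | h1 | h1 | h1 | h1 | h1 | h1 | h1 | h1 | h1 | h1 | h1 | h1 | h1 | h1 | h1 | h1 | h1 | h1 | h1 | h1 | h1 | h1 | h1 <;> omega
  · refine UnitaryThirtyOneSixtySix.no_minRank_16 hbr hirr hΘ hΘΘ hP hQ hP31 hQ66 hadd hsmul hsymm hPQ hdefP hdefQ
      hadj (fun B' hB' hΘB' hB'Θ => ?_) hB hΘB hBΘ h
    have h2 := hSm B' hB' hΘB' hB'Θ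
    rcases hbad B' hB' hΘB' hB'Θ with h1 | h1 | h1 | h1 | h1 | h1 | h1 | h1 | h1 | h1 | h1 | h1 | h1 | h1 | h1 | h1 | h1 | h1 | h1 | h1 | h1 | h1 | h1 | h1 | h1 | h1 | h1 | h1 <;> omega
  · refine UnitaryThirtyOneSixtySix.no_minRank_17 hbr hirr hΘ hΘΘ hP hQ hP31 hQ66 hadd hsmul hsymm hPQ hdefP hdefQ
      hadj (fun B' hB' hΘB' hB'Θ => ?_) hB hΘB hBΘ h
    have h2 := hSm B' hB' hΘB' hB'Θ
    rcases hbad B' hB' hΘB' hB'Θ with h1 | h1 | h1 | h1 | h1 | h1 | h1 | h1 | h1 | h1 | h1 | h1 | h1 | h1 | h1 | h1 | h1 | h1 | h1 | h1 | h1 | h1 | h1 | h1 | h1 | h1 | h1 | h1 <;> omega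
  · refine UnitaryThirtyOneSixtySix.no_minRank_18 hbr hirr hΘ hΘΘ hP hQ hP31 hQ66 hadd hsmul hsymm hPQ hdefP hdefQ
      hadj (fun B' hB' hΘB' hB'Θ => ?_) hB hΘB hBΘ h
    have h2 := hSm B' hB' hΘB' hB'Θ
    rcases hbad B' hB' hΘB' hB'Θ with h1 | h1 | h1 | h1 | h1 | h1 | h1 | h1 | h1 | h1 | h1 | h1 | h1 | h1 | h1 | h1 | h1 | h1 | h1 | h1 | h1 | h1 | h1 | h1 | h1 | h1 | h1 | h1 <;> omega
  · refine UnitaryThirtyOneSixtySix.no_minRank_19 hbr hirr hΘ hΘΘ hP hQ hP31 hQ66 hadd hsmul hsymm hPQ hdefP hdefQ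
      hadj (fun B' hB' hΘB' hB'Θ => ?_) hB hΘB hBΘ h
    have h2 := hSm B' hB' hΘB' hB'Θ
    rcases hbad B' hB' hΘB' hB'Θ with h1 | h1 | h1 | h1 | h1 | h1 | h1 | h1 | h1 | h1 | h1 | h1 | h1 | h1 | h1 | h1 | h1 | h1 | h1 | h1 | h1 | h1 | h1 | h1 | h1 | h1 | h1 | h1 <;> omega
  · refine UnitaryThirtyOneSixtySix.no_minRank_20 hbr hirr hΘ hΘΘ hP hQ hP31 hQ66 hadd hsmul hsymm hPQ hdefP hdefQ
      hadj (fun B' hB' hΘB' hB'Θ => ?_) hB hΘB hBΘ h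
    have h2 := hSm B' hB' hΘB' hB'Θ
    rcases hbad B' hB' hΘB' hB'Θ with h1 | h1 | h1 | h1 | h1 | h1 | h1 | h1 | h1 | h1 | h1 | h1 | h1 | h1 | h1 | h1 | h1 | h1 | h1 | h1 | h1 | h1 | h1 | h1 | h1 | h1 | h1 | h1 <;> omega
  · refine UnitaryThirtyOneSixtySix.no_minRank_21 hbr hirr hΘ hΘΘ hP hQ hP31 hQ66 hadd hsmul hsymm hPQ hdefP hdefQ
      hadj (fun B' hB' hΘB' hB'Θ => ?_) hB hΘB hBΘ h
    have h2 := hSm B' hB' hΘB' hB'Θ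
    rcases hbad B' hB' hΘB' hB'Θ with h1 | h1 | h1 | h1 | h1 | h1 | h1 | h1 | h1 | h1 | h1 | h1 | h1 | h1 | h1 | h1 | h1 | h1 | h1 | h1 | h1 | h1 | h1 | h1 | h1 | h1 | h1 | h1 <;> omega
  · refine UnitaryThirtyOneSixtySix.no_minRank_22 hbr hirr hΘ hΘΘ hP hQ hP31 hQ66 hadd hsmul hsymm hPQ hdefP hdefQ
      hadj (fun B' hB' hΘB' hB'Θ => ?_) hB hΘB hBΘ h
    have h2 := hSm B' hB' hΘB' hB'Θ
    rcases hbad B' hB' hΘB' hB'Θ with h1 | h1 | h1 | h1 | h1 | h1 | h1 | h1 | h1 | h1 | h1 | h1 | h1 | h1 | h1 | h1 | h1 | h1 | h1 | h1 | h1 | h1 | h1 | h1 | h1 | h1 | h1 | h1 <;> omega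
  · refine UnitaryThirtyOneSixtySix.no_minRank_23 hbr hirr hΘ hΘΘ hP hQ hP31 hQ66 hadd hsmul hsymm hPQ hdefP hdefQ
      hadj (fun B' hB' hΘB' hB'Θ => ?_) hB hΘB hBΘ h
    have h2 := hSm B' hB' hΘB' hB'Θ
    rcases hbad B' hB' hΘB' hB'Θ with h1 | h1 | h1 | h1 | h1 | h1 | h1 | h1 | h1 | h1 | h1 | h1 | h1 | h1 | h1 | h1 | h1 | h1 | h1 | h1 | h1 | h1 | h1 | h1 | h1 | h1 | h1 | h1 <;> omega
  · refine UnitaryThirtyOneSixtySix.no_minRank_24 hbr hirr hΘ hΘΘ hP hQ hP31 hQ66 hadd hsmul hsymm hPQ hdefP hdefQ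
      hadj (fun B' hB' hΘB' hB'Θ => ?_) hB hΘB hBΘ h
    have h2 := hSm B' hB' hΘB' hB'Θ
    rcases hbad B' hB' hΘB' hB'Θ with h1 | h1 | h1 | h1 | h1 | h1 | h1 | h1 | h1 | h1 | h1 | h1 | h1 | h1 | h1 | h1 | h1 | h1 | h1 | h1 | h1 | h1 | h1 | h1 | h1 | h1 | h1 | h1 <;> omega
  · refine UnitaryThirtyOneSixtySix.no_minRank_25 hbr hirr hΘ hΘΘ hP hQ hP31 hQ66 hadd hsmul hsymm hPQ hdefP hdefQ
      hadj (fun B' hB' hΘB' hB'Θ => ?_) hB hΘB hBΘ h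
    have h2 := hSm B' hB' hΘB' hB'Θ
    rcases hbad B' hB' hΘB' hB'Θ with h1 | h1 | h1 | h1 | h1 | h1 | h1 | h1 | h1 | h1 | h1 | h1 | h1 | h1 | h1 | h1 | h1 | h1 | h1 | h1 | h1 | h1 | h1 | h1 | h1 | h1 | h1 | h1 <;> omega
  · refine UnitaryThirtyOneSixtySix.no_minRank_26 hbr hirr hΘ hΘΘ hP hQ hP31 hQ66 hadd hsmul hsymm hPQ hdefP hdefQ
      hadj (fun B' hB' hΘB' hB'Θ => ?_) hB hΘB hBΘ h
    have h2 := hSm B' hB' hΘB' hB'Θ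
    rcases hbad B' hB' hΘB' hB'Θ with h1 | h1 | h1 | h1 | h1 | h1 | h1 | h1 | h1 | h1 | h1 | h1 | h1 | h1 | h1 | h1 | h1 | h1 | h1 | h1 | h1 | h1 | h1 | h1 | h1 | h1 | h1 | h1 <;> omega
  · refine UnitaryThirtyOneSixtySix.no_minRank_27 hbr hirr hΘ hΘΘ hP hQ hP31 hQ66 hadd hsmul hsymm hPQ hdefP hdefQ
      hadj (fun B' hB' hΘB' hB'Θ => ?_) hB hΘB hBΘ h
    have h2 := hSm B' hB' hΘB' hB'Θ
    rcases hbad B' hB' hΘB' hB'Θ with h1 | h1 | h1 | h1 | h1 | h1 | h1 | h1 | h1 | h1 | h1 | h1 | h1 | h1 | h1 | h1 | h1 | h1 | h1 | h1 | h1 | h1 | h1 | h1 | h1 | h1 | h1 | h1 <;> omega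
  · refine UnitaryThirtyOneSixtySix.no_minRank_28 hbr hirr hΘ hΘΘ hP hQ hP31 hQ66 hadd hsmul hsymm hPQ hdefP hdefQ
      hadj (fun B' hB' hΘB' hB'Θ => ?_) hB hΘB hBΘ h
    have h2 := hSm B' hB' hΘB' hB'Θ
    rcases hbad B' hB' hΘB' hB'Θ with h1 | h1 | h1 | h1 | h1 | h1 | h1 | h1 | h1 | h1 | h1 | h1 | h1 | h1 | h1 | h1 | h1 | h1 | h1 | h1 | h1 | h1 | h1 | h1 | h1 | h1 | h1 | h1 <;> omega
  · refine UnitaryThirtyOneSixtySix.no_minRank_29 hbr hirr hΘ hΘΘ hP hQ hP31 hQ66 hadd hsmul hsymm hPQ hdefP hdefQ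
      hadj (fun B' hB' hΘB' hB'Θ => ?_) hB hΘB hBΘ h
    have h2 := hSm B' hB' hΘB' hB'Θ
    rcases hbad B' hB' hΘB' hB'Θ with h1 | h1 | h1 | h1 | h1 | h1 | h1 | h1 | h1 | h1 | h1 | h1 | h1 | h1 | h1 | h1 | h1 | h1 | h1 | h1 | h1 | h1 | h1 | h1 | h1 | h1 | h1 | h1 <;> omega
  · refine UnitaryThirtyOneSixtySix.no_minRank_30 hbr hirr hΘ hΘΘ hP hQ hP31 hQ66 hadd hsmul hsymm hPQ hdefP hdefQ
      hadj (fun B' hB' hΘB' hB'Θ => ?_) hB hΘB hBΘ h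
    have h2 := hSm B' hB' hΘB' hB'Θ
    rcases hbad B' hB' hΘB' hB'Θ with h1 | h1 | h1 | h1 | h1 | h1 | h1 | h1 | h1 | h1 | h1 | h1 | h1 | h1 | h1 | h1 | h1 | h1 | h1 | h1 | h1 | h1 | h1 | h1 | h1 | h1 | h1 | h1 <;> omega
  · -- `m = 31 = dim P`: the full-rank chain would give `31 ∣ 66`
    have hSa : ∀ Y ∈ 𝔊, Θ * Y = Y → Y * Θ = -Y → Y ≠ 0 → Module.finrank ℂ (LinearMap.range Y) = 31 := by
      intro Y hY hΘY hYΘ hY0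
      have h1 := hle Y hΘY; have h2 := hBmin Y hY hΘY hYΘ hY0; omega
    have hdvd := UnitaryConstantRank.dvd_of_rank_eq_finrank 66 hbr hirr hΘ hΘΘ hP hQ (by omega) hP31 hQ66 hadd hsymm hPQ
      hdefP hdefQ hadj hSa ⟨B, hB, hΘB, hBΘ, hB0⟩
    omega

/-- **The mirror core `(66, 31)`** (apply `eq_top_of_smul` to `−Θ`). [cite: Ribet1983, Thm. 3]
[cite: Gordon1997, Thm. 6.3 (3)] -/
theorem UnitaryThirtyOneSixtySix.eq_top_of_smul' [FiniteDimensional ℂ W] {𝔊 : Submodule ℂ (Module.End ℂ W)}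
    (hbr : ∀ Y ∈ 𝔊, ∀ Z ∈ 𝔊, Y * Z - Z * Y ∈ 𝔊)
    (hirr : ∀ U : Submodule ℂ W, (∀ A ∈ 𝔊, ∀ u ∈ U, A u ∈ U) → U = ⊥ ∨ U = ⊤)
    {Θ : Module.End ℂ W} (hΘ : Θ ∈ 𝔊) (hΘΘ : Θ * Θ = 1)
    {P Q : Submodule ℂ W} (hP : ∀ x, x ∈ P ↔ Θ x = x) (hQ : ∀ x, x ∈ Q ↔ Θ x = -x)
    (hP66 : Module.finrank ℂ P = 66) (hQ31 : Module.finrank ℂ Q = 31)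
    {s : W → W → ℂ} (hadd : ∀ x y z, s (x + y) z = s x z + s y z)
    (hsmul : ∀ (c : ℂ) (x y : W), s (c • x) y = c * s x y) (hsymm : ∀ x y, s y x = starRingEnd ℂ (s x y))
    (hPQ : ∀ p ∈ P, ∀ q ∈ Q, s p q = 0) (hdefP : ∀ p ∈ P, s p p = 0 → p = 0) (hdefQ : ∀ q ∈ Q, s q q = 0 → q = 0)
    (hadj : ∀ X ∈ 𝔊, ∃ Y ∈ 𝔊, ∀ x y, s (X x) y = s x (Y y)) : 𝔊 = ⊤ := by
  have hnΘ : -Θ ∈ 𝔊 := Submodule.neg_mem _ hΘ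
  have hnΘΘ : (-Θ) * (-Θ) = 1 := by rw [neg_mul_neg, hΘΘ]
  exact UnitaryThirtyOneSixtySix.eq_top_of_smul hbr hirr hnΘ hnΘΘ (P := Q) (Q := P)
    (fun x => by rw [hQ, LinearMap.neg_apply, neg_eq_iff_eq_neg]) (fun x => by rw [hP, LinearMap.neg_apply, neg_inj])
    hQ31 hP66 hadd hsmul hsymm (fun p hp q hq => by rw [hsymm, hPQ q hq p hp, map_zero]) hdefQ hdefP hadj

end HodgeStructure

end Literature.AlgebraicGeometry.Motives

end
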